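import Literature.MathematicalPhysics.QuantumFieldTheory.Balaban1983to89.B9Eq389CubeLocalisedProjectionProfile
import Literature.MathematicalPhysics.QuantumFieldTheory.Balaban1983to89.B9Eq349PBlockDecayWindow

/-!
# `Balaban1983to89.B9Eq389CubeLocalisedProjectionWindow` — T. Bałaban, *Propagators for lattice gauge theories in a background field*, Commun. Math. Phys. **99**
# (1985) 389–434 [Balaban1985BackgroundPropagators] Cor 3.6 p. 408 with (3.87)–(3.89) p. 409, Thm 3.11 p. 416, (3.49) p. 399: **S-P6′(β) AT THE LATTICE FOR EVERY
# SUFFICIENTLY FLAT BACKGROUND — `∃ ε₀ > 0, κ > 0, C ≥ 0` FIRST (before the volume and the background), then for every volume, every `U ∈ U₁` with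
# `‖U − 1‖ ≤ ε₀` and mutually adjoint transports, every support set `Y₀`, radius `r₀ > 0`, collar width `R > 0` and every `w` supported over `Y₀`:
# `‖w − projR Δ^η_U (Q̃′(U) × N.mkQ) w‖ ≤ ‖w − R(U)w‖ + (C·K_{d+1}(κ∕2)·e^{−(κ∕2)r₀} + √8·a₁ + 8·(a₀ + C_Ψ·b₀))·‖w‖` with `a₁ = √(d+1)·(L∕R)·(M_φM_φ′ + 1)`,
# `a₀ = 2(d+1)L²∕R`, `b₀ = (1 + 2M_φM_φ′ε₀)^{(d+1)(L−1)}(d+1)L∕R`, `C_Ψ` (K6E)'s constant at `ε₀` — NO size letter, NO window letter left displayed: the block decay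
# `(C, κ)` of `1 − R(U)` comes from ne9-leaf-01 g85's `B9Eq349PBlockDecayWindow.exists_oneSubR_decay_of_small_background`, the windows `3^{d+1}ρ′ < 1` and
# `γ ≤ c_Δ` (at `a′ = 1`, `γ = 1∕8`, `c_P = √8`) are met by shrinking `ε₀` (continuity at `0`)** — route R2′ STEP B7′∕B8′, S-P6′(β), instance-ledger row L10 (loc)

statement-level skeleton of published theorems with citation tags; proofs where landed; nothing here is a claim about the Yang–Mills mass gap

CITATION HEADER (lean-in-tree rule).  Audit cell `pub-balaban`, sub-cell `t4`, BINDER row NE9; filed by NE9 formalisation-swarm LEAF PROVER 05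
(`b2b-balaban-t4-ne9-formalise-leaf-05`, gen 77) as the COMPOSITION BY NAME of this lineage's `B9Eq389CubeLocalisedProjectionProfile.norm_sub_projR_collar_le`
(itself on ne9-leaf-06 g69's `B9Eq387CubeLocalisedProjectionBumpSection` §3) with ne9-leaf-01 g85's `B9Eq349PBlockDecayWindow.exists_oneSubR_decay_of_small_background`
(the `∃ε₀` block decay of `1 − R(U)`, dimension `d + 1`) and `B9Eq349BlockMultipliers.exists_block_clm_family` (the (K1) block family), plus elementary continuity at
`ε = 0` for the two scalar windows (the pattern of ne9-leaf-01's `B9Eq349KWAssemblySmallField`).  Source READ in the held text [Balaban1985BackgroundPropagators]: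
p. 408 Cor 3.6 («If a configuration U satisfies (3.35) … then Theorems 3.1–3.3 hold for the operators G′_□(U), …»), p. 409 (3.87)–(3.89), p. 416 Thm 3.11, p. 399
(3.49).  NOTHING of print's estimates is asserted; `ε₀`, `κ`, `C` are the ROUTE's, by continuity ∕ composition, UNVALUED.

WHAT IS PROVED (sorry-free; proof lane — no `def`; [folklore] composition BY NAME + continuity at `0`).
* **`exists_window_norm_sub_projR_collar_le`** — the displayed statement above (`3 ≤ L`, `ηL = 1`, `c₁ = L^{d+1}c₀`, `φ` with `0 ≤ M_φ, M_φ′`, `0 < η`); inside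
  the `∀`: `U ∈ U₁`, `‖U(b) − 1‖ ≤ ε₀`, `hRS`, the collinear-bond letter `0 ≤ β₂` (enters `C_Ψ` only), `Y₀`, `0 < r₀`, `0 < R`, the collar-cube submodule `N` (letter
  `hN`), `w` supported over `Y₀`; also returned: `ε₀ ≤ 1` and the window fact `3^{d+1}((1 + 2M_φM_φ′ε₀)^{(d+1)(L−1)} − 1) < 1` (so `C_Ψ ≥ 0` is visible).
HONEST SCOPE.  The END of S-P6′(β) at the lattice for ONE averaging step on the diagonal `Lη = 1`: every operator slot, every size letter and every scalar
window of the junction chain (`B9Eq387CubeLocalisedProjection` → `…Lattice` → `…BumpSection` → `…Profile`) is discharged; what remains is STRUCTURE (`U₁`,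
`hRS`, the fibre reading `φ`) and the ROUTE's unvalued `ε₀, κ, C`.  NOT print's Cor 3.6 (print's cube operators have restricted domains; here the cube projection
is the orthogonal projection onto `Δ(N(Q′) ∩ N_□)`); NOT NE9 (cell pub-balaban: NE9 NOT PRINTED ∕ NOT PROVED; «NE9 ⇐ the named binders»; row WALLED ON A MODEL
(O-NE9-1; #5 UNRULED); spine PROVED 0∕9; rung (B)+1 on a finite T⁴ — NOT infinite volume, NOT mass gap, NOT Clay; HONEST DEPENDENCY: continuum YM on T⁴ ⇐ BetaPertH
∧ nine spine estimates (0/9 proved); BetaPertH ⇐ (D1) ∧ (D4) ∧ CAP+tail; G-an2-4 gates asym, D1 and NE2/3/4).  NEW file; nothing modified.  Net new unproved facts: 0.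
-/

noncomputable section

set_option autoImplicit false

open scoped InnerProductSpace BigOperators Topology
open Filter

namespace Literature.MathematicalPhysics.QuantumFieldTheory.Balaban1983to89.B9Eq389CubeLocalisedProjectionWindow

open B4Sect5Torus (TSite tdist)
open B4Sect5Proof (latticeConst)
open B9SectCLatticeCarrier (Bond unshift)
open B9Eq311L2Pairing (WL2)
open B9Eq319QprimeTorus (fineP blockCoord)
open B11Eq103H1Complex (SiteL2K covLaplaceSiteK projR)
open B7Prop1Explicit (U1)
open B9Eq310HessianOperator (adTransportW)
open B9Eq326OperatorAssembly (QprimeW RofU)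
open B9Eq349BlockMultipliers (exists_block_clm_family)
open B9Eq349PBlockDecayWindow (exists_oneSubR_decay_of_small_background)
open B9Eq389CubeLocalisedProjectionProfile (norm_sub_projR_collar_le)

variable {d : ℕ} (L : ℕ) [NeZero L] (hL : 3 ≤ L) {𝔸 : Type*} [NormedRing 𝔸] [NormedAlgebra ℂ 𝔸] [NormOneClass 𝔸]
  {W : Type*} [NormedAddCommGroup W] [InnerProductSpace ℂ W] [FiniteDimensional ℂ W] (φ : W ≃ₗ[ℂ] 𝔸) {Mφ Mφ' : ℝ}
  (hφ : ∀ w, ‖φ w‖ ≤ Mφ * ‖w‖) (hφ' : ∀ X, ‖φ.symm X‖ ≤ Mφ' * ‖X‖) (hMφ : 0 ≤ Mφ) (hMφ' : 0 ≤ Mφ')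
  (c₀ : ℝ) [Fact (0 < c₀)] (η : ℝ) (hη : 0 < η) (c₁ : ℝ) [Fact (0 < c₁)] (hc : c₁ = (L : ℝ) ^ (d + 1) * c₀) (hηL : η * L = 1)

/-- a real function continuous at `0` with value `< u` there is `< u` on a neighbourhood `|ε| < δ`. [folklore] -/
private theorem exists_delta_lt {f : ℝ → ℝ} (hf : Continuous f) {u : ℝ} (h0 : f 0 < u) : ∃ δ : ℝ, 0 < δ ∧ ∀ ε : ℝ, |ε| < δ → f ε < u := by
  have hev : ∀ᶠ ε in 𝓝 (0 : ℝ), f ε < u := (hf.tendsto 0).eventually (eventually_lt_nhds h0)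
  obtain ⟨δ, hδ, hball⟩ := Metric.eventually_nhds_iff.mp hev
  exact ⟨δ, hδ, fun ε hε => hball (by rwa [Real.dist_eq, sub_zero])⟩

include hL hφ hφ' hMφ hMφ' hη hc hηL in
/-- **S-P6′(β) AT THE LATTICE FOR EVERY SUFFICIENTLY FLAT BACKGROUND, `∃ ε₀ > 0` FIRST** (Cor 3.6 with (3.87)–(3.89); Thm 3.11; (3.49)): given the structure letters
(`3 ≤ L`, `ηL = 1`, `c₁ = L^{d+1}c₀`, the fibre reading `φ` with `M_φ, M_φ′ ≥ 0`, `η > 0`) there are `ε₀ ∈ (0, 1]`, `κ > 0`, `C ≥ 0` — BEFORE the volume and the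
background — with `3^{d+1}((1 + 2M_φM_φ′ε₀)^{(d+1)(L−1)} − 1) < 1` and, for every volume `m`, every `U ∈ U₁` with `‖U(b) − 1‖ ≤ ε₀` and `hRS`, every collinear-bond
letter `β₂ ≥ 0`, every `Y₀`, `r₀ > 0`, `R > 0`, every submodule `N` of the collar cube `{y : ∃ y₀ ∈ Y₀, d_m(y₀, y) < r₀ + R}` (letter `hN`) and every `w` supported
over `Y₀`:  `‖w − projR Δ^η_U (Q̃′(U) × N.mkQ) w‖ ≤ ‖w − R(U)w‖ + (C·K_{d+1}(κ∕2)·e^{−(κ∕2)r₀} + a₁·c_P + (a₀ + C_Ψ·b₀)·c_P²)·‖w‖` with `c_P = (√(1∕8))⁻¹`,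
`a₁ = √(d+1)·((L∕R)(M_φM_φ′ + 1))`, `a₀ = (d+1)·(2L²∕R)`, `b₀ = (1 + 2M_φM_φ′ε₀)^{(d+1)(L−1)}·((d+1)(L∕R))`, `C_Ψ` = (K6E)'s constant at `(ε₀, β₂)` — written out.
[folklore] composition BY NAME (`norm_sub_projR_collar_le` at `a′ = 1`, `γ = 1∕8`; `exists_oneSubR_decay_of_small_background`; `exists_block_clm_family`; continuity).
[cite: Balaban1985BackgroundPropagators, Cor 3.6 p.408, (3.87)–(3.89) p.409, Thm 3.11 p.416, (3.49) p.399, (3.19) p.393, (3.23) p.394] -/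
theorem exists_window_norm_sub_projR_collar_le :
    ∃ ε₀ κ C : ℝ, 0 < ε₀ ∧ ε₀ ≤ 1 ∧ 0 < κ ∧ 0 ≤ C ∧
      3 ^ (d + 1) * ((1 + 2 * Mφ * Mφ' * ε₀) ^ ((d + 1) * (L - 1)) - 1) < 1 ∧
      ∀ (m : Fin (d + 1) → ℕ) [∀ i, NeZero (m i)] [∀ i, NeZero (fineP L m i)]
        (U : Bond (d + 1) (fineP L m) → 𝔸ˣ) (_hU : ∀ b, U b ∈ U1 𝔸) (_hUε : ∀ b, ‖(U b : 𝔸) - 1‖ ≤ ε₀)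
        (_hRS : ∀ (b : Bond (d + 1) (fineP L m)) (v u : W), ⟪adTransportW φ U b v, u⟫_ℂ = ⟪v, adTransportW φ (fun b => (U b)⁻¹) b u⟫_ℂ)
        {β₂ : ℝ} (_hβ : 0 ≤ β₂) (_hcol : ∀ (y : TSite (d + 1) (fineP L m)) (μ : Fin (d + 1)), ‖(U (y, μ) : 𝔸) - U (unshift μ y, μ)‖ ≤ β₂)
        (Y₀ : Finset (TSite (d + 1) m)) {r₀ R : ℝ} (_hr₀ : 0 < r₀) (_hR : 0 < R)
        {N : Submodule ℂ (SiteL2K ℂ (d + 1) (fineP L m) c₀ W)}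
        (_hN : ∀ f : SiteL2K ℂ (d + 1) (fineP L m) c₀ W, f ∈ N ↔
          ∀ x : TSite (d + 1) (fineP L m), blockCoord L m x ∉ {y : TSite (d + 1) m | ∃ y₀ ∈ Y₀, tdist m y₀ y < r₀ + R} →
            WL2.equiv ℂ (fun _ : TSite (d + 1) (fineP L m) => c₀) W f x = 0)
        (w : SiteL2K ℂ (d + 1) (fineP L m) c₀ W)
        (_hw : ∀ x : TSite (d + 1) (fineP L m), blockCoord L m x ∉ Y₀ → WL2.equiv ℂ (fun _ : TSite (d + 1) (fineP L m) => c₀) W w x = 0),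
        ‖w - projR (covLaplaceSiteK (c₀ := c₀) ((η : ℂ))⁻¹ (adTransportW φ U) (adTransportW φ fun b => (U b)⁻¹))
              ((((WL2.linearEquiv ℂ ℂ (fun _ : TSite (d + 1) m => c₁)).symm.toLinearMap ∘ₗ QprimeW L m φ U (c₀ := c₀))).prod N.mkQ) w‖ ≤
          ‖w - RofU L m φ η U (c₀ := c₀) w‖ +
            (C * latticeConst (d + 1) (κ / 2) * Real.exp (-(κ / 2 * r₀)) +
              Real.sqrt ((d + 1 : ℕ) : ℝ) * ((L : ℝ) / R * (Mφ * Mφ' + 1)) * (Real.sqrt (1 / 8))⁻¹ +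
              (((d + 1 : ℕ) : ℝ) * (2 * (L : ℝ) ^ 2 / R) +
                ((1 - 3 ^ (d + 1) * ((1 + 2 * Mφ * Mφ' * ε₀) ^ ((d + 1) * (L - 1)) - 1))⁻¹ *
                  ((d + 1 : ℕ) * (3 / 2 : ℝ) ^ (d + 1) * (9 * Real.pi ^ 2) * 2 ^ (d + 1 - 1) +
                    (d + 1 : ℕ) * 3 ^ (d + 1) * ((L : ℝ) ^ 2 * (Mφ' * Mφ * (2 * β₂ + 4 * ε₀ ^ 2))) +
                    (d + 1 : ℕ) * (3 / 2 : ℝ) ^ (d + 1) * (6 * Real.pi) * 2 ^ (d + 1 - 1) * ((L : ℝ) * (2 * Mφ * Mφ' * ε₀)))) *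
                ((1 + 2 * Mφ * Mφ' * ε₀) ^ ((d + 1) * (L - 1)) * (((d + 1 : ℕ) : ℝ) * ((L : ℝ) / R)))) * ((Real.sqrt (1 / 8))⁻¹) ^ 2) * ‖w‖ := by
  have hMM : 0 ≤ 2 * Mφ * Mφ' := by positivity
  -- the block decay of `1 − R(U)` with `∃ ε₀′` first (ne9-leaf-01)
  obtain ⟨ε₁, κ, C, hε₁, hκ, hC, H⟩ := exists_oneSubR_decay_of_small_background (d := d) L φ hφ hφ' hMφ hMφ' c₀ η hη c₁ hc 1 one_pos hηL
  -- the two scalar windows by continuity at `0`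
  obtain ⟨Pf, hPf⟩ : ∃ Pf : ℝ → ℝ, Pf = fun ε => (1 + 2 * Mφ * Mφ' * ε) ^ ((d + 1) * (L - 1)) := ⟨_, rfl⟩
  have hPfc : Continuous Pf := by rw [hPf]; fun_prop
  have hPf0 : Pf 0 = 1 := by rw [hPf]; simp
  obtain ⟨qf, hqf⟩ : ∃ qf : ℝ → ℝ, qf = fun ε => (3 : ℝ) ^ (d + 1) * (Pf ε - 1) := ⟨_, rfl⟩
  have hqfc : Continuous qf := by rw [hqf]; fun_prop
  have hqf0 : qf 0 < 1 := by rw [hqf]; simp [hPf0]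
  obtain ⟨δ₁, hδ₁, hq1⟩ := exists_delta_lt hqfc hqf0
  obtain ⟨gf, hgf⟩ : ∃ gf : ℝ → ℝ, gf = fun ε => Real.sqrt ((d + 1 : ℕ) : ℝ) * (‖((η : ℂ))⁻¹‖ * (2 * Mφ * Mφ' * ε)) +
      (Real.sqrt ((d + 1 : ℕ) : ℝ) * (‖((η : ℂ))⁻¹‖ * (2 * Mφ * Mφ' * ε))) ^ 2 + 1 * ((Pf ε - 1) * (2 + (Pf ε - 1))) := ⟨_, rfl⟩
  have hgfc : Continuous gf := by rw [hgf]; fun_prop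
  have hgf0 : gf 0 < 1 / 8 := by rw [hgf]; simp [hPf0]
  obtain ⟨δ₂, hδ₂, hg2⟩ := exists_delta_lt hgfc hgf0
  -- the smallness letter
  obtain ⟨ε₀, hε₀def⟩ : ∃ ε₀ : ℝ, ε₀ = min (min ε₁ 1) (min (δ₁ / 2) (δ₂ / 2)) := ⟨_, rfl⟩
  have hε₀ : 0 < ε₀ := by rw [hε₀def]; exact lt_min (lt_min hε₁ one_pos) (lt_min (by positivity) (by positivity))
  have hε₀1 : ε₀ ≤ 1 := by rw [hε₀def]; exact (min_le_left _ _).trans (min_le_right _ _)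
  have hε₀ε₁ : ε₀ ≤ ε₁ := by rw [hε₀def]; exact (min_le_left _ _).trans (min_le_left _ _)
  have hε₀δ₁ : |ε₀| < δ₁ := by
    rw [abs_of_pos hε₀, hε₀def]; exact ((min_le_right _ _).trans (min_le_left _ _)).trans_lt (half_lt_self hδ₁)
  have hε₀δ₂ : |ε₀| < δ₂ := by
    rw [abs_of_pos hε₀, hε₀def]; exact ((min_le_right _ _).trans (min_le_right _ _)).trans_lt (half_lt_self hδ₂)
  have hPfε : Pf ε₀ = (1 + 2 * Mφ * Mφ' * ε₀) ^ ((d + 1) * (L - 1)) := by rw [hPf]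
  have hq : 3 ^ (d + 1) * ((1 + 2 * Mφ * Mφ' * ε₀) ^ ((d + 1) * (L - 1)) - 1) < 1 := by
    have h := hq1 ε₀ hε₀δ₁
    rw [hqf] at h
    simp only [hPfε] at h
    exact h
  have hγc : (1 / 8 : ℝ) ≤ 1 / (2 + 2 / 1) -
      (Real.sqrt ((d + 1 : ℕ) : ℝ) * (‖((η : ℂ))⁻¹‖ * (2 * Mφ * Mφ' * ε₀)) + (Real.sqrt ((d + 1 : ℕ) : ℝ) * (‖((η : ℂ))⁻¹‖ * (2 * Mφ * Mφ' * ε₀))) ^ 2 +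
        1 * (((1 + 2 * Mφ * Mφ' * ε₀) ^ ((d + 1) * (L - 1)) - 1)) * (2 + ((1 + 2 * Mφ * Mφ' * ε₀) ^ ((d + 1) * (L - 1)) - 1))) := by
    have h := (hg2 ε₀ hε₀δ₂).le
    rw [hgf] at h
    simp only [hPfε] at h
    have e : (1 : ℝ) / (2 + 2 / 1) = 1 / 4 := by norm_num
    rw [e]
    linarith only [h]
  refine ⟨ε₀, κ, C, hε₀, hε₀1, hκ, hC, hq, fun m _ _ U hU hUε hRS β₂ hβ hcol Y₀ r₀ R hr₀ hR N hN w hw => ?_⟩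
  -- a (K1) block family and its block-decay letter at this background
  obtain ⟨PS, hPS⟩ := exists_block_clm_family (𝕜 := ℂ) (w := fun _ : TSite (d + 1) (fineP L m) => c₀) (V := W) (blockCoord L m)
  have hdec := fun y₀ y₁ => H m U hU (fun b => (hUε b).trans hε₀ε₁) hRS PS hPS y₀ y₁
  have hm : ∀ i, 1 ≤ m i := fun i => Nat.one_le_iff_ne_zero.mpr (NeZero.ne (m i))
  have hLη : (L : ℝ) * η = 1 := by rw [mul_comm]; exact hηL
  have hc' : c₀ * (L : ℝ) ^ (d + 1) = c₁ := by rw [hc, mul_comm]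
  have hγ : (0 : ℝ) < 1 / 8 := by norm_num
  exact norm_sub_projR_collar_le L m φ η U hL hLη hc' hPS hC hκ hdec hRS hMφ hφ hMφ' hφ' hU hε₀.le hUε hβ hcol hq one_pos hγ hγc _ rfl _ rfl
    rfl rfl Y₀ hr₀ hR hN rfl rfl rfl hm w hw

end Literature.MathematicalPhysics.QuantumFieldTheory.Balaban1983to89.B9Eq389CubeLocalisedProjectionWindow

end
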